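import Summits.QuantumFields.BalabanUV.T4Continuum.Spine.NE2.ComposedRemainderGaugeTowerGeometric

/-!
# T⁴ programme, spine node NE2 (U1a) — R14 W3d, file 3: THE TIER-B TRANSPORTER DATA `R` IS THE TOP LEVEL OF THE TOWER READ THROUGH `Ad` — `hreg` from letters on `U`
# (cell `pub-balaban-gaps`, seat ne2 gen 7; after `ComposedRemainderGaugeTowerGeometric`)

Up to `ComposedRemainderGaugeTowerGeometric.composed_full_averaging_rate_of_geometricLetters` the tier-B transporter data `R` (ROOT B's `Rg`, the background field of problem `k`
in lattice units `L^{−k}`, hypothesis `hreg : RegularTransporters L M R α_R β_R`) and the towers `U k` of unitary bond variables (whose `Ad`-images feed the composed averaging and (124)'s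
remainders) are INDEPENDENT data.  In print they are ONE object: `R^{(k)} = R(U_k) = Ad U_k` for the level-`k` (finest) field of problem `k` ([B9] (3.3) p. 390, (3.19) p. 393; the coarser
levels are its averages).  THIS FILE makes the identification: **`topAdT hF U`** `k ν b := adT hF (U k) k ν b` and
 * **`regularTransporters_topAdT`**: the (3.35)-shape class `RegularTransporters L M (topAdT hF U) (2α_U) (2β_U)` from the size letter `‖U^{(k)}_k − 1‖ ≤ α_U/L^k` (`hUa` at the top
   level) and ONE MORE LETTER, the lattice-Lipschitz bound `‖U^{(k)}_k(x + e_μ, ν) − U^{(k)}_k(x, ν)‖ ≤ β_U/L^{2k}` ([B9] (3.35): `|∇^ηA| < α₁(L^jη)^{−2}`), via `‖Ad U − 1‖ ≤ 2‖U − 1‖`,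
   `‖Ad U − Ad U′‖ ≤ 2‖U − U′‖` (`AdjointFieldInstance`);
 * **`composed_full_averaging_rate_of_regularGaugeTowers`** — the (3.26)-shape END with print's composed averaging + (124)'s remainders whose ONLY field data are the towers `U`: letters
   `α_U` (sizes), `β_U` (lattice-Lipschitz of the top level), `σ_U, θ_c` (chain closeness), `p ≤ p_U/L^{2i}` (plaquette, `d·p_U ≤ 1/16`), `Y_x ∈ P`; node NE3 BY NAME on the readings of
   `regClass (topAdT hF U)`; the frame `hF`; `P₄`; `ρ`; ONE closed-form smallness inequality (with `α_R := 2α_U`, `β_R := 2β_U`);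
 * **`composed_full_averaging_rate_of_regularGaugeTowers_flat`** — non-vacuity at `U ≡ 1`.
REMAINS (located, unchanged): the letters themselves for Bałaban's minimiser and its (15)-averages (G2 = NE3 + F6 (ζ)), (W2″), (R7).
HONEST FRAMING (T4-DAG p. 1).  A COMPOSITION of kernel theorems about MODEL objects; `U`, `P₄`, the frame are DATA asserted by nobody; NE3 OPEN by name; nothing of Bałaban's asserted beyond
the displayed readings; NOT an instance of Bałaban's minimiser or of (3.35); NOT NE2, NOT [B9] (3.16)/(3.26) or [B7] (124)/(143) as printed; **NE2 (U1a) NOT PROVED**; spine PROVED 0/9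
unchanged; NOT continuum YM / infinite volume / mass gap / Clay.  HONEST DEPENDENCY: continuum YM on T⁴ ⇐ BetaPertH ∧ nine spine estimates (0/9 proved).  No `sorry`.
-/

noncomputable section

open scoped BigOperators ComplexConjugate Matrix Matrix.Norms.L2Operator Kronecker
open Finset (range)

namespace Summit.QuantumFields.BalabanUV.T4Continuum.NE2.ComposedRemainderGaugeTowerRegular

open Literature.MathematicalPhysics.QuantumFieldTheory.Balaban1983to89.B5Prop11Plancherel (Tor fine unitVec Cst)
open Literature.MathematicalPhysics.QuantumFieldTheory.Balaban1983to89.B5G183RateUnitTower (lev lev_neZero)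
open Literature.MathematicalPhysics.QuantumFieldTheory.Balaban1983to89.T4EtaRateMin (LocalRate)
open Summit.QuantumFields.BalabanUV.Beta.AdjointCarrierWiringEnd (CompFamily)
open Summit.QuantumFields.BalabanUV.T4Continuum
open Summit.QuantumFields.BalabanUV.T4Continuum.BalabanAveragedTowerUnit (idx Qlev cast_lev')
open Summit.QuantumFields.BalabanUV.T4Continuum.BlockPairingGeometry (tau)
open Summit.QuantumFields.BalabanUV.T4Continuum.KingPairingPlantedLaw (JpcT calDalev CJ)
open Summit.QuantumFields.BalabanUV.T4Continuum.GramPerturbationLaw (C2gram)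
open Summit.QuantumFields.BalabanUV.T4Continuum.CovariantAveragingTower (TowerLimitRate)
open Summit.QuantumFields.BalabanUV.T4Continuum.BackgroundResolventTower (PerturbationLaws Cpert)
open Summit.QuantumFields.BalabanUV.T4Continuum.PerturbationAlgebra (perturbationLaws_zero perturbationLaws_mono)
open Summit.QuantumFields.BalabanUV.T4Continuum.RegularBackgroundTower (RegularTransporters regClass betaNE3)
open Summit.QuantumFields.BalabanUV.T4Continuum.ColourCovariantLaplacian (kappaCol)
open Summit.QuantumFields.BalabanUV.T4Continuum.NE2FromNE3 (bgReadings)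
open Summit.QuantumFields.BalabanUV.T4Continuum.CovariantAveragingSummand (kappaQ)
open Summit.QuantumFields.BalabanUV.T4Continuum.NE2BalabanLayer (tierBPert kappaB C2B)
open Summit.QuantumFields.BalabanUV.T4Continuum.NE2BalabanGauge (liftR)
open Summit.QuantumFields.BalabanUV.T4Continuum.GaugeTermPerturbationLaw (oneR)
open Summit.QuantumFields.BalabanUV.T4Continuum.NE2BalabanFlatWitness (liftR_oneR regularTransporters_flat localRate_flat)
open Summit.QuantumFields.BalabanUV.T4Continuum.NE2.CovariantTableBalaban (TBal)
open Summit.QuantumFields.BalabanUV.T4Continuum.NE2.ComposedAveragingMean (thetaZero)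
open Summit.QuantumFields.BalabanUV.T4Continuum.NE2.ComposedAveragingRemainder (avgPertFull)
open Summit.QuantumFields.BalabanUV.T4Continuum.NE2.ComposedRemainderTower (Erem cR)
open Summit.QuantumFields.BalabanUV.T4Continuum.NE2.OneStepRemainderLoopCoeff (YxT remCoeffOf)
open Summit.QuantumFields.BalabanUV.T4Continuum.NE2.OneStepRemainderLoopFlat (YxT_one)
open Summit.QuantumFields.BalabanUV.T4Continuum.NE2.AdjointFieldInstance (adRep norm_adRep_sub_one_le norm_adRep_sub_adRep_le dist1_unitaryGroup)
open Summit.QuantumFields.BalabanUV.T4Continuum.NE2.ComposedRemainderGaugeTower (fundT adT)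
open Summit.QuantumFields.BalabanUV.T4Continuum.NE2.ComposedRemainderGaugeTowerFlat (flatU fundT_flatU)
open Summit.QuantumFields.BalabanUV.T4Continuum.NE2.ComposedRemainderRateLetters (GamU EU CrU)
open Summit.QuantumFields.BalabanUV.T4Continuum.NE2.ComposedRemainderGaugeTowerGeometric (composed_full_averaging_rate_of_geometricLetters)

variable {d : ℕ} (L : ℕ) [NeZero L] (M : Fin d → ℕ) [hM : ∀ μ, NeZero (M μ)]
  {n : Type} [Fintype n] [DecidableEq n] {ι : Type} [Fintype ι] [DecidableEq ι] {c : ℝ} {P : Submodule ℝ (Matrix n n ℂ)} {e : ι → Matrix n n ℂ}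
  (hF : CompFamily c P e) (a : ℝ) (ha : 0 < a) [Nonempty n] [Nonempty ι]

/-! ## §1 The tier-B data as the top level of the tower read through `Ad` -/

/-- **`R^{(k)} := Ad U^{(k)}_k`** — the tier-B transporter data of problem `k` is the FINEST level of its tower read through the adjoint representation
([B9] (3.3) p. 390, (3.19) p. 393). [cite: Balaban1985BackgroundPropagators, (3.3) p.390, (3.19) p.393 (shape)] [folklore] -/
def topAdT (U : ℕ → (i : ℕ) → Fin d → (idx L M i → Matrix.unitaryGroup n ℂ)) : (k : ℕ) → Fin d → (idx L M k → Matrix ι ι ℂ) := fun k => adT L M hF (U k) k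

omit [NeZero L] hM [Nonempty n] [Nonempty ι] in
/-- entries of `topAdT`. [folklore] -/
theorem topAdT_apply (U : ℕ → (i : ℕ) → Fin d → (idx L M i → Matrix.unitaryGroup n ℂ)) (k : ℕ) (ν : Fin d) (b : idx L M k) :
    topAdT L M hF U k ν b = adRep hF (U k k ν b) := rfl

omit [NeZero L] hM [Nonempty n] [Nonempty ι] in
/-- at the flat tower `topAdT` is the flat transporter datum `liftR (oneR)` of `NE2BalabanFlatWitness`. [folklore] -/
theorem topAdT_flat : topAdT L M hF (fun _ => flatU L M (n := n)) = liftR L M (oneR L M (o := ι)) := by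
  rw [liftR_oneR]; funext k ν b
  rw [topAdT_apply]
  exact map_one (adRep hF)

omit hM [Nonempty ι] in
/-- **THE (3.35)-SHAPE CLASS OF `Ad U_top` FROM TWO LETTERS ON THE FUNDAMENTAL TOP LEVEL**: sizes `‖U^{(k)}_k − 1‖ ≤ α_U/L^k` and lattice-Lipschitz
`‖U^{(k)}_k(x + e_μ, ν) − U^{(k)}_k(x, ν)‖ ≤ β_U/L^{2k}` give `RegularTransporters L M (topAdT hF U) (2α_U) (2β_U)`. [cite: Balaban1985BackgroundPropagators, (3.35) p.396 (shape)] [folklore] -/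
theorem regularTransporters_topAdT {U : ℕ → (i : ℕ) → Fin d → (idx L M i → Matrix.unitaryGroup n ℂ)} {αU βU : ℝ} (hαU : 0 ≤ αU) (hβU : 0 ≤ βU)
    (hUa : ∀ k ν b, ‖(U k k ν b : Matrix n n ℂ) - 1‖ ≤ αU / (lev L k : ℕ))
    (hUb : ∀ k ν μ (b : idx L M k), ‖(U k k ν (tau (fine (lev L k) M) μ b) : Matrix n n ℂ) - (U k k ν b : Matrix n n ℂ)‖ ≤ βU / ((lev L k : ℕ) : ℝ) ^ 2) :
    RegularTransporters L M (topAdT L M hF U) (2 * αU) (2 * βU) where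
  nonneg := ⟨by positivity, by positivity⟩
  size k ν b := by
    have hlev : (0 : ℝ) < (lev L k : ℕ) := by rw [cast_lev']; exact pow_pos (Nat.cast_pos.mpr (Nat.pos_of_ne_zero (NeZero.ne L))) k
    rw [norm_smul, Complex.norm_natCast, topAdT_apply]
    have h : ‖adRep hF (U k k ν b) - 1‖ ≤ 2 * (αU / (lev L k : ℕ)) :=
      (norm_adRep_sub_one_le hF (U k k ν b)).trans (by rw [dist1_unitaryGroup]; exact mul_le_mul_of_nonneg_left (hUa k ν b) zero_le_two)
    calc ((lev L k : ℕ) : ℝ) * ‖adRep hF (U k k ν b) - 1‖ ≤ (lev L k : ℕ) * (2 * (αU / (lev L k : ℕ))) := mul_le_mul_of_nonneg_left h hlev.le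
      _ = 2 * αU := by field_simp
  lipschitz k ν μ b := by
    have hlev : (0 : ℝ) < (lev L k : ℕ) := by rw [cast_lev']; exact pow_pos (Nat.cast_pos.mpr (Nat.pos_of_ne_zero (NeZero.ne L))) k
    rw [norm_smul, Complex.norm_natCast, topAdT_apply, topAdT_apply]
    have h : ‖adRep hF (U k k ν (tau (fine (lev L k) M) μ b)) - adRep hF (U k k ν b)‖ ≤ 2 * (βU / ((lev L k : ℕ) : ℝ) ^ 2) :=
      (norm_adRep_sub_adRep_le hF (U k k ν (tau (fine (lev L k) M) μ b)) (U k k ν b)).trans (mul_le_mul_of_nonneg_left (hUb k ν μ b) zero_le_two)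
    calc ((lev L k : ℕ) : ℝ) * ‖adRep hF (U k k ν (tau (fine (lev L k) M) μ b)) - adRep hF (U k k ν b)‖ ≤ (lev L k : ℕ) * (2 * (βU / ((lev L k : ℕ) : ℝ) ^ 2)) :=
          mul_le_mul_of_nonneg_left h hlev.le
      _ = 2 * βU / (lev L k : ℕ) := by field_simp

/-! ## §2 The END whose only field data are the towers `U` -/

/-- **THE (3.26)-SHAPE END WITH THE FULL LINEARISED COMPOSED AVERAGING, THE TIER-B DATA BEING THE TOWER's TOP LEVEL**: `composed_full_averaging_rate_of_geometricLetters` with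
`R := topAdT hF U`, `α_R := 2α_U`, `β_R := 2β_U`, `hreg` PROVED (`regularTransporters_topAdT`).  Displayed: the towers `U` with FIVE letters (`α_U` sizes, `β_U` top-level lattice-Lipschitz,
`σ_U, θ_c` chain closeness, `p ≤ p_U/L^{2i}` plaquette with `d·p_U ≤ 1/16`), `Y_x ∈ P`, the frame `hF`, node NE3 BY NAME on `regClass (topAdT hF U)`, `P₄`, `ρ`, ONE closed-form smallness inequality.
[cite: Balaban1985BackgroundPropagators, (3.3) p.390, (3.15)–(3.16) p.393, (3.26) p.395, (3.35) p.396; Balaban1985Averaging, (114) p.34, (124)–(126) p.36, (139)–(143) p.39; King1986, Lemma 4.5 (4.38) p.674 (method)] [folklore] -/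
theorem composed_full_averaging_rate_of_regularGaugeTowers (hL : 2 ≤ L) (hd : 1 ≤ d)
    {U : ℕ → (i : ℕ) → Fin d → (idx L M i → Matrix.unitaryGroup n ℂ)} {αU βU σU θc ρ pU : ℝ}
    (hαU : 0 ≤ αU) (hβU : 0 ≤ βU) (hσU : 0 ≤ σU) (hθ0 : 0 ≤ θc) (hθ1 : θc ≤ 1) (hθρ : θc ≤ ρ) (hρ : 3 / (2 * (L : ℝ)) ≤ ρ) (hρ1 : ρ < 1)
    (hUa : ∀ k i ν b, ‖(U k i ν b : Matrix n n ℂ) - 1‖ ≤ αU / (lev L i : ℕ))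
    (hUb : ∀ k ν μ (b : idx L M k), ‖(U k k ν (tau (fine (lev L k) M) μ b) : Matrix n n ℂ) - (U k k ν b : Matrix n n ℂ)‖ ≤ βU / ((lev L k : ℕ) : ℝ) ^ 2)
    (hUc : ∀ k i ν b, i ≤ k → ‖(U (k + 1) i ν b : Matrix n n ℂ) - (U k i ν b : Matrix n n ℂ)‖ ≤ σU * θc ^ k / (lev L i : ℕ))
    {C : ℝ} (hC : 0 ≤ C) (hNE3 : LocalRate (bgReadings L M (regClass L M (topAdT L M hF U))) C ((L : ℝ)⁻¹))
    {p : ℕ → ℕ → ℝ} (hp0 : ∀ k i, 0 ≤ p k i)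
    (hp : ∀ k i (x : Tor (fine (L * lev L i) M)) (ν μ : Fin d),
      ‖fundT L M (U k) (i + 1) ν (x, μ) * fundT L M (U k) (i + 1) μ (x + unitVec (fine (L * lev L i) M) ν, μ) - fundT L M (U k) (i + 1) μ (x, μ) * fundT L M (U k) (i + 1) ν (x + unitVec (fine (L * lev L i) M) μ, μ)‖ ≤ p k (i + 1))
    (hpU0 : 0 ≤ pU) (hpU : ∀ k i, p k i ≤ pU * ((L : ℝ)⁻¹) ^ (2 * i)) (hpUs : d * pU ≤ 1 / 16) (hYP : ∀ k i x μ r, YxT L M (fundT L M (U k)) i x μ r ∈ P)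
    {P₄ : (k : ℕ) → Matrix (idx L M k × ι) (idx L M k × ι) ℂ} {κ₄ C₄ : ℝ}
    (hP₄ : PerturbationLaws (fun k => calDalev L M a ha k ⊗ₖ (1 : Matrix ι ι ℂ)) P₄ (fun k => JpcT L M k ⊗ₖ (1 : Matrix ι ι ℂ)) κ₄ (fun k => C₄ * ρ ^ k))
    (hsmall : kappaB ι d a (2 * αU) (2 * βU) C (kappaQ d a (a : ℂ) (Fintype.card ι * (Real.exp ((((d + 1) * L : ℕ) : ℝ) * (2 * αU)) - 1)
      + (1 + Fintype.card ι * (Real.exp ((((d + 1) * L : ℕ) : ℝ) * (2 * αU)) - 1)) * cR d L ι * GamU d pU * Real.exp (EU ι d L αU pU))) κ₄ < 1) :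
    TowerLimitRate (fun k => Qlev L M k ⊗ₖ (1 : Matrix ι ι ℂ)) ((L : ℝ) ^ d)
      (fun k => (calDalev L M a ha k ⊗ₖ (1 : Matrix ι ι ℂ)
        + tierBPert L M (topAdT L M hF U) (avgPertFull L M a (fun k => TBal L M (adT L M hF (U k)) k) (fun k => Erem L M (adT L M hF (U k)) (remCoeffOf L M (fundT L M (U k)) c e (adT L M hF (U k))) k)) P₄ k)⁻¹)
      (Cpert (kappaB ι d a (2 * αU) (2 * βU) C (kappaQ d a (a : ℂ) (Fintype.card ι * (Real.exp ((((d + 1) * L : ℕ) : ℝ) * (2 * αU)) - 1)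
          + (1 + Fintype.card ι * (Real.exp ((((d + 1) * L : ℕ) : ℝ) * (2 * αU)) - 1)) * cR d L ι * GamU d pU * Real.exp (EU ι d L αU pU))) κ₄) (2 * d * Cst d a) (CJ d a)
        (C2B ι d L a (2 * αU) (2 * βU) C
          (a * C2gram (Cst d a) 1 (Fintype.card ι * (Real.exp ((((d + 1) * L : ℕ) : ℝ) * (2 * αU)) - 1)
              + (1 + Fintype.card ι * (Real.exp ((((d + 1) * L : ℕ) : ℝ) * (2 * αU)) - 1)) * cR d L ι * GamU d pU * Real.exp (EU ι d L αU pU)) (2 * d * Cst d a) (CJ d a) (Cst d a)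
            (Cst d a * Fintype.card ι * (thetaZero d L (2 * αU) (2 * σU) + (Real.exp ((((d + 1) * L : ℕ) : ℝ) * (2 * αU)) - 1)) + CrU ι d L a αU σU pU)) C₄) 0 1) ρ :=
  composed_full_averaging_rate_of_geometricLetters L M hF a ha hL hd (regularTransporters_topAdT L M hF hαU hβU (fun k ν b => hUa k k ν b) hUb) hC hNE3
    hαU hσU hθ0 hθ1 hθρ hρ hρ1 hUa hUc hp0 hp hpU0 hpU hpUs hYP hP₄ hsmall

/-! ## §3 Non-vacuity at the flat tower -/

include ha in
/-- **NON-VACUITY**: at `U ≡ 1` (`P₄ = 0`, all letters `0`, `C = 0`) every displayed binder of `composed_full_averaging_rate_of_regularGaugeTowers` holds — in particular node NE3's shape on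
`regClass (topAdT hF 1) = regClass (flat)` (`localRate_flat`) —, for any component family, `L ≥ 2`, `d ≥ 1`, `3/(2L) ≤ ρ < 1`.  NOT a statement about non-trivial data; NE2 NOT proved. [folklore] -/
theorem composed_full_averaging_rate_of_regularGaugeTowers_flat (hL : 2 ≤ L) (hd : 1 ≤ d) {ρ : ℝ} (hρ : 3 / (2 * (L : ℝ)) ≤ ρ) (hρ1 : ρ < 1) :
    ∃ Cp : ℝ, TowerLimitRate (fun k => Qlev L M k ⊗ₖ (1 : Matrix ι ι ℂ)) ((L : ℝ) ^ d)
      (fun k => (calDalev L M a ha k ⊗ₖ (1 : Matrix ι ι ℂ)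
        + tierBPert L M (topAdT L M hF (fun _ => flatU L M)) (avgPertFull L M a (fun k => TBal L M (adT L M hF (flatU L M)) k)
            (fun k => Erem L M (adT L M hF (flatU L M)) (remCoeffOf L M (fundT L M (flatU L M)) c e (adT L M hF (flatU L M))) k)) (fun _ => 0) k)⁻¹) Cp ρ := by
  have hρ0 : 0 ≤ ρ := le_trans (by positivity) hρ
  have hone : ∀ (i : ℕ) (ν : Fin d) (b : idx L M i), ((flatU L M (n := n) i ν b : Matrix.unitaryGroup n ℂ) : Matrix n n ℂ) = 1 := fun _ _ _ => rfl
  have hP₄ : PerturbationLaws (fun k => calDalev L M a ha k ⊗ₖ (1 : Matrix ι ι ℂ)) (fun k => (0 : Matrix (idx L M k × ι) (idx L M k × ι) ℂ))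
      (fun k => JpcT L M k ⊗ₖ (1 : Matrix ι ι ℂ)) 0 (fun k => (0 : ℝ) * ρ ^ k) :=
    perturbationLaws_mono perturbationLaws_zero le_rfl fun k => le_of_eq (by ring)
  have hexp : Real.exp ((((d + 1) * L : ℕ) : ℝ) * (2 * 0)) - 1 = 0 := by rw [mul_zero, mul_zero, Real.exp_zero, sub_self]
  have hG : GamU d 0 = 0 := by unfold GamU; rw [mul_zero]
  have hsmall : kappaB ι d a (2 * 0) (2 * 0) 0 (kappaQ d a (a : ℂ) (Fintype.card ι * (Real.exp ((((d + 1) * L : ℕ) : ℝ) * (2 * 0)) - 1)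
      + (1 + Fintype.card ι * (Real.exp ((((d + 1) * L : ℕ) : ℝ) * (2 * 0)) - 1)) * cR d L ι * GamU d 0 * Real.exp (EU ι d L 0 0))) 0 < 1 := by
    rw [hexp, hG, mul_zero]
    simp [kappaB, kappaCol, kappaQ, betaNE3]
  have hNE3 : LocalRate (bgReadings L M (regClass L M (topAdT L M hF (fun _ => flatU L M (n := n))))) 0 ((L : ℝ)⁻¹) := by
    rw [topAdT_flat]; exact localRate_flat L M le_rfl (inv_nonneg.mpr (Nat.cast_nonneg L))
  refine ⟨_, composed_full_averaging_rate_of_regularGaugeTowers L M hF a ha hL hd (U := fun _ => flatU L M) (αU := 0) (βU := 0) (σU := 0) (θc := 0) (pU := 0)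
    le_rfl le_rfl le_rfl le_rfl zero_le_one hρ0 hρ hρ1
    (fun _ _ _ _ => by rw [hone, sub_self, norm_zero]; positivity) (fun _ _ _ _ => by rw [hone, hone, sub_self, norm_zero]; positivity)
    (fun _ _ _ _ _ => by rw [hone, sub_self, norm_zero]; positivity) le_rfl hNE3
    (p := fun _ _ => 0) (fun _ _ => le_rfl) (fun _ _ _ _ _ => by rw [fundT_flatU]; simp) le_rfl (fun _ _ => by rw [zero_mul]) (by rw [mul_zero]; norm_num)
    (fun _ i x μ r => by rw [fundT_flatU, YxT_one]; exact P.zero_mem) hP₄ hsmall⟩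

end Summit.QuantumFields.BalabanUV.T4Continuum.NE2.ComposedRemainderGaugeTowerRegular

end
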